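import Mathlib
import HarnessLib

/-!
# Route `KLProgramme` — crux K3 ENGINE (stmt-HubbardSuperconductivity-20437), stub (e) proof-input «(e)-D-ROWS»: HALF-DEGREE RE-INDEXING OF THE FAR SOURCE
# (seat hubbard-kl-k3c4-p1 g24, VL lane; pure Finset algebra; DROWS-SCOPE-g24 v10 §12.2 N7 — the far part of `…LipDefectStep.lipSourceDefect_le` → the
#  `hstep` of `…TwoVolumeLipFarSourceLaw.farSrc_le_law`)

The FAR bracket of the graded covariance-defect step (`…TwoVolumeDefectStepGraded`, instantiated in `…TwoVolumeLipDefectStep.lipSourceDefect_le`) is written in FULL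
degrees: `Σ_{a < n+2} Σ_{b′ < n+2} [a + b′ = n+1] f (a+1) (b′+1)` (the two factors of the Leibniz term have degrees `a+1`, `b′+1` with sum `n+3 = 2p+2`), whereas the
law reading `farSrc_le_law` (k3c4-p1 g22) is written in HALF degrees `Σ_{a′ ∈ [1,p]} f (2a′) (2(p+1−a′))`.  Since the Polchinski-path states are EVEN, the
profiles vanish in odd degrees, and the two sums agree.  This file is that re-indexing, for any `f : ℕ → ℕ → ℝ` vanishing when its first argument is odd.

* **`sum_range_antidiag_succ_eq_sum_Icc_half`** — `n + 1 = 2p`, `f (2a′+1) b = 0` ⇒ `Σ_{a<n+2} Σ_{b′<n+2} [a+b′=n+1] f (a+1) (b′+1) = Σ_{a′∈Icc 1 p} f (2a′) (2(p+1−a′))`.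

Pure algebra; nothing about the model is asserted.
-/

namespace Summit.HubbardSuperconductivity.HubbardSuperconductivity.Theorems.TwoVolumeLip

set_option linter.dupNamespace false -- summit = problem name (single-conjunct summit), D-0017

open Finset

/-- The antidiagonal double sum collapses to a single sum over the first index. -/
theorem sum_range_antidiag_succ_eq (n : ℕ) (f : ℕ → ℕ → ℝ) :
    ∑ a ∈ range (n + 2), ∑ b' ∈ range (n + 2), (if a + b' = n + 1 then f (a + 1) (b' + 1) else 0) =
      ∑ a ∈ range (n + 2), f (a + 1) (n + 2 - a) := by
  refine sum_congr rfl fun a ha => ?_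
  have ha' : a ≤ n + 1 := Nat.lt_succ_iff.1 (mem_range.1 ha)
  rw [sum_ite_eq_of_eq (n + 1 - a)]
  · rw [show n + 1 - a + 1 = n + 2 - a by omega]
  · exact mem_range.2 (by omega)
  · intro b' _; constructor <;> intro h <;> omega
where
  /-- `Σ_{b ∈ s} (if P b then g b else 0) = g b₀` when `P b ↔ b = b₀` and `b₀ ∈ s`. -/
  sum_ite_eq_of_eq {s : Finset ℕ} {P : ℕ → Prop} [DecidablePred P] {g : ℕ → ℝ} (b₀ : ℕ) (hb₀ : b₀ ∈ s)
      (hP : ∀ b ∈ s, P b ↔ b = b₀) : ∑ b ∈ s, (if P b then g b else 0) = g b₀ := by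
    rw [← sum_filter, filter_congr fun b hb => hP b hb, filter_eq' s b₀, if_pos hb₀, sum_singleton]

/-- **Half-degree re-indexing**: for `n + 1 = 2p` and `f` vanishing at odd first argument,
`Σ_{a<n+2} Σ_{b′<n+2} [a+b′=n+1] f (a+1) (b′+1) = Σ_{a′ ∈ Icc 1 p} f (2a′) (2(p+1−a′))`. -/
theorem sum_range_antidiag_succ_eq_sum_Icc_half {n p : ℕ} (hnp : n + 1 = 2 * p) (f : ℕ → ℕ → ℝ) (hodd : ∀ a b, f (2 * a + 1) b = 0) :
    ∑ a ∈ range (n + 2), ∑ b' ∈ range (n + 2), (if a + b' = n + 1 then f (a + 1) (b' + 1) else 0) =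
      ∑ a' ∈ Icc 1 p, f (2 * a') (2 * (p + 1 - a')) := by
  rw [sum_range_antidiag_succ_eq]
  -- split `range (n+2)` into odd `a` (even degree `a+1 = 2a′`, `a′ ∈ [1,p]`) and even `a` (odd degree, vanishing)
  have hsplit : ∑ a ∈ range (n + 2), f (a + 1) (n + 2 - a) =
      ∑ a ∈ (range (n + 2)).filter (fun a => Odd a), f (a + 1) (n + 2 - a) := by
    rw [← sum_filter_add_sum_filter_not (range (n + 2)) (fun a => Odd a)]
    have hz : ∑ a ∈ (range (n + 2)).filter (fun a => ¬ Odd a), f (a + 1) (n + 2 - a) = 0 := by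
      refine sum_eq_zero fun a ha => ?_
      obtain ⟨k, hk⟩ := Nat.not_odd_iff_even.1 (mem_filter.1 ha).2
      rw [hk, show k + k + 1 = 2 * k + 1 by ring]
      exact hodd k _
    rw [hz, add_zero]
  rw [hsplit]
  -- the bijection `a ↦ (a+1)/2` between the odd `a < n+2` and `a′ ∈ [1,p]`
  refine sum_nbij' (fun a => (a + 1) / 2) (fun a' => 2 * a' - 1) ?_ ?_ ?_ ?_ ?_
  · intro a ha
    have h := mem_filter.1 ha
    obtain ⟨k, hk⟩ := h.2
    have hr := mem_range.1 h.1
    rw [mem_Icc]; omega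
  · intro a' ha'
    have h := mem_Icc.1 ha'
    exact mem_filter.2 ⟨mem_range.2 (by omega), ⟨a' - 1, by omega⟩⟩
  · intro a ha
    obtain ⟨k, hk⟩ := (mem_filter.1 ha).2
    omega
  · intro a' ha'
    have h := mem_Icc.1 ha'
    omega
  · intro a ha
    obtain ⟨k, hk⟩ := (mem_filter.1 ha).2
    have hr := mem_range.1 (mem_filter.1 ha).1
    subst hk
    congr 1 <;> omega

end Summit.HubbardSuperconductivity.HubbardSuperconductivity.Theorems.TwoVolumeLip
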